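import Summits.ValiantsHypothesis.ValiantsHypothesis.Theorems.LacunarySymmetroidMatrixDescartesVSQDesign
import Summits.ValiantsHypothesis.ValiantsHypothesis.Theorems.LacunarySymmetroidMatrixDescartesVSQTriDefs

/-!
# `MatrixDescartes` census, `m = 3` row — exponent BOOKKEEPING of the tridiagonal all-`K` family

HONEST FRAMING.  Integer inequalities only (val-V1-extremal engine seat val-v1x-eng-6 g2), all derived from the `m = 2`
bookkeeping `…VSQDesign` by shifts: used by `…VSQTriLaw` (`ζ_sym(3,K) ≥ 7K − 13` for every `K ≥ 4`).  Nothing here mentions the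
crux `MatrixDescartes` (stmt-ValiantsHypothesis-18050) or `VP ≠ VNP`.

CONTENT (`n = K − 2 ≥ 2`, `x = log_B t`, `σ = 4n + 4`, `δ = n(n+3)/2`, `2δ = n² + 3n`).  Level `1` and level `2` of the tridiagonal
family are the `m = 2` system in the delayed variable `y = x − σ`, so their bookkeeping is `…VSQDesign` verbatim; what is new is
(i) the level-`0` link `Q₀ = B^{−δ} b` against the partner `P₁` whose constant has height `qa` (`gap0_low`, `gap0_blkA`, `gap0_W`:
the `m = 2` gaps shifted by `2δ = 4(n+1)² − qa`), (ii) the WEAKNESS of the finished link `0` at all later times (`gap0_late`,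
from `gap_mid` and the slope `n² + 5n > 4n` of `P₀`'s top term), (iii) the weakness of the not-yet-started link `1` at level-`0`
times (`gap1_early`, from `gap_low`), (iv) the flat partner: `a_0` dominates `a` for all `y ≤ −1` (`ea_low_dom'`), and the
dominant term of a level always sits above its constant (`qa_lt_ea_blk`, `qa_lt_ea_n`, `qa_lt_ea_top`).
[folklore] Elementary.
-/

set_option linter.dupNamespace false
set_option autoImplicit false

namespace Summit.ValiantsHypothesis.ValiantsHypothesis.Theorems.LacunarySymmetroidMatrixDescartes.VSQ

/-- `2δ = n² + 3n`. [folklore] -/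
theorem two_dlt (n : ℕ) : 2 * (dlt n : ℤ) = (n : ℤ) ^ 2 + 3 * n := by
  obtain ⟨k, hk⟩ := Nat.even_mul_succ_self n
  have e : n * (n + 3) = 2 * (k + n) := by
    have : n * (n + 3) = n * (n + 1) + 2 * n := by ring
    rw [this, hk]; ring
  have hd : dlt n = k + n := by unfold dlt; rw [e, Nat.mul_div_cancel_left _ (by norm_num)]
  rw [hd]
  have e' : ((n * (n + 3) : ℕ) : ℤ) = ((2 * (k + n) : ℕ) : ℤ) := by rw [e]
  push_cast at e' ⊢
  linarith

/-- `ea n 0 y = qa`. [folklore] -/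
theorem ea_zero (n : ℕ) (y : ℤ) : ea n 0 y = qa n := by unfold ea; rw [haN_zero, dN_zero]; ring

/-- `ec n 0 y = 4(n+1)²`. [folklore] -/
theorem ec_zero (n : ℕ) (y : ℤ) : ec n 0 y = 4 * ((n : ℤ) + 1) ^ 2 := by unfold ec; rw [hcN_zero, dN_zero]; ring

/-- `4(n+1)² = qa + 2δ`. [folklore] -/
theorem hc0_eq (n : ℕ) : 4 * ((n : ℤ) + 1) ^ 2 = qa n + 2 * (dlt n : ℤ) := by rw [two_dlt]; unfold qa; ring

/-- the flat partner: `a_0` dominates `a` for every `y ≤ −1`. [folklore] -/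
theorem ea_low_dom' {n v : ℕ} {y : ℤ} (hn : 2 ≤ n) (hv1 : 1 ≤ v) (hv : v ≤ n + 1) (hy : y ≤ -1) :
    ea n v y + 1 ≤ ea n 0 y := by
  have h0 := ea_low_dom hn hv1 hv
  unfold ea at h0 ⊢
  rw [dN_zero] at h0 ⊢
  have hd : (0 : ℤ) ≤ (dN n v : ℤ) := by positivity
  nlinarith [mul_le_mul_of_nonneg_right hy hd]

/-- every `a`-term is at most the constant for `y ≤ −1`. [folklore] -/
theorem ea_le_qa {n : ℕ} {y : ℤ} (hn : 2 ≤ n) (hy : y ≤ -1) (l : Fin (n + 2)) : ea n l y ≤ qa n := by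
  rcases Nat.eq_zero_or_pos (l : ℕ) with h0 | h1
  · rw [h0, ea_zero]
  · have := ea_low_dom' hn h1 (Nat.lt_succ_iff.mp l.isLt) hy
    rw [ea_zero] at this; linarith

/-- level `0`, `x = −1`: the link `0` is weak against `a_0 · (const of P₁)`. [folklore] -/
theorem gap0_low {n : ℕ} (hn : 2 ≤ n) : 2 * (eb n 1 (-1) - dlt n) + 1 ≤ ea n 0 (-1) + qa n := by
  have h := gap_low hn
  rw [ec_zero, hc0_eq] at h
  linarith

/-- level `0`, `x = 2w − 1`: the link `0` is weak against `a_w · (const of P₁)`. [folklore] -/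
theorem gap0_blkA {n w : ℕ} (hw1 : 1 ≤ w) (hwn : w ≤ n) :
    2 * (eb n 1 (2 * w - 1) - dlt n) + 1 ≤ ea n w (2 * w - 1) + qa n := by
  have h := gap_blkA (n := n) hw1 hwn
  rw [ec_zero, hc0_eq] at h
  linarith

/-- level `0`, `x = 2n + 2w − 1`: the link `0` is strong. [folklore] -/
theorem gap0_W {n w : ℕ} (hn : 2 ≤ n) (hw1 : 1 ≤ w) (hwn : w ≤ n) :
    ea n n (2 * n + 2 * w - 1) + qa n + 1 ≤ 2 * (eb n w (2 * n + 2 * w - 1) - dlt n) := by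
  have h := gap_W hn hw1 hwn
  rw [ec_zero, hc0_eq] at h
  linarith

/-- the finished link `0` stays weak: `2(eb_n(x) − δ) + 1 ≤ ea_{n+1}(x) + qa` for all `x ≥ 4n + 3`. [folklore] -/
theorem gap0_late {n : ℕ} {x : ℤ} (hn : 2 ≤ n) (hx : 4 * (n : ℤ) + 3 ≤ x) :
    2 * (eb n n x - dlt n) + 1 ≤ ea n (n + 1) x + qa n := by
  have h := gap_mid hn
  rw [ec_zero, hc0_eq] at h
  have hn1 : 1 ≤ n := by omega
  unfold ea eb at h ⊢
  rw [dN_top, dN_blk hn1 le_rfl] at h ⊢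
  have hn' : (2 : ℤ) ≤ n := by exact_mod_cast hn
  nlinarith [mul_nonneg (by linarith : (0 : ℤ) ≤ x - (4 * n + 3)) (by nlinarith : (0 : ℤ) ≤ (n : ℤ) ^ 2 + 5 * n - 4 * n)]

/-- the not-yet-started link `1` is weak: `2 eb_1(y) + 1 ≤ qa + 4(n+1)²` for all `y ≤ −1`. [folklore] -/
theorem gap1_early {n : ℕ} {y : ℤ} (hn : 2 ≤ n) (hy : y ≤ -1) :
    2 * eb n 1 y + 1 ≤ qa n + 4 * ((n : ℤ) + 1) ^ 2 := by
  have h := gap_low hn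
  rw [ea_zero, ec_zero] at h
  have hn1 : 1 ≤ n := by omega
  unfold eb at h ⊢
  rw [dN_blk le_rfl hn1] at h ⊢
  nlinarith [mul_le_mul_of_nonneg_right hy (by positivity : (0 : ℤ) ≤ (n : ℤ) + 1)]

/-- the dominant block term sits above the constant. [folklore] -/
theorem qa_lt_ea_blk {n w : ℕ} (hn : 2 ≤ n) (hw1 : 1 ≤ w) (hwn : w ≤ n) : qa n + 1 ≤ ea n w (2 * w - 1) := by
  have := ea_blk_dom (v := 0) hn hw1 hwn (by omega) (by omega)
  rwa [ea_zero] at this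

/-- `a_n` at the `b`-points sits above the constant. [folklore] -/
theorem qa_lt_ea_n {n w : ℕ} (hn : 2 ≤ n) (hw1 : 1 ≤ w) (hwn : w ≤ n) : qa n + 1 ≤ ea n n (2 * n + 2 * w - 1) := by
  have := ea_n_dom (v := 0) hn hw1 hwn (by omega) (by omega)
  rwa [ea_zero] at this

/-- the top term sits above the constant from `x = 4n + 3` on. [folklore] -/
theorem qa_lt_ea_top {n : ℕ} {x : ℤ} (hn : 2 ≤ n) (hx : 4 * (n : ℤ) + 3 ≤ x) : qa n + 1 ≤ ea n (n + 1) x := by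
  have := ea_top_dom (v := 0) hn (by omega) hx
  rwa [ea_zero] at this

/-- the link-`0` gap across a level-`1` bracket: right-endpoint `b`-bound against left-endpoint `a`-terms. [folklore] -/
theorem gap0_bracket1 {n w : ℕ} (hn : 2 ≤ n) (hw1 : 1 ≤ w) :
    2 * (eb n n ((sg n : ℤ) + 2 * n + 2 * w + 1) - dlt n) + 1 ≤
      ea n (n + 1) ((sg n : ℤ) + 2 * n + 2 * w - 1) + ea n n (2 * n + 2 * w - 1) := by
  have hn' : (2 : ℤ) ≤ n := by exact_mod_cast hn
  have hw1' : (1 : ℤ) ≤ w := by exact_mod_cast hw1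
  have hn1 : 1 ≤ n := by omega
  have hsg : (sg n : ℤ) = 4 * n + 4 := by unfold sg; push_cast; ring
  have h1 := gap0_late hn (x := (sg n : ℤ) + 2 * n + 2 * w - 1) (by rw [hsg]; linarith)
  have h2 : eb n n ((sg n : ℤ) + 2 * n + 2 * w + 1) = eb n n ((sg n : ℤ) + 2 * n + 2 * w - 1) + 4 * n := by
    unfold eb; rw [dN_blk hn1 le_rfl]; ring
  have h3 : qa n + 8 * n ≤ ea n n (2 * n + 2 * w - 1) := by
    unfold ea; rw [haN_blk hn1 le_rfl, dN_blk hn1 le_rfl]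
    nlinarith [mul_nonneg (by linarith : (0 : ℤ) ≤ n) (sub_nonneg.2 hw1')]
  linarith

end Summit.ValiantsHypothesis.ValiantsHypothesis.Theorems.LacunarySymmetroidMatrixDescartes.VSQ
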